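import Summits.KontsevichZagierPeriods.KontsevichZagierPeriods.Theses.MultivaluedCoV
import Summits.KontsevichZagierPeriods.KontsevichZagierPeriods.Theorems.HurwitzMicroSectorsNormalFormPrincipleSplitGlue

/-!
# `MultiCoVKernel` (stmt-KontsevichZagierPeriods-2873), line `pi-cut`: proof skeleton v1 (crux-strategist)

Crux (route MultivaluedCoV, deciding; RESTATED re-audit): the kernel conjecture of the enlarged calculus
KZ⁺. The line is the `[π]`-LOCALISATION CUT filed on the route as items (rev 2):

* S1 `stub_piLocalKernel`  — item stmt-KontsevichZagierPeriods-0541 BY NAME (`MultivaluedCoV.AyoubPiLocalKernel`,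
  verbatim twin of AyoubSpecialisation's): Conjecture 1 for the period ring localised at `[π]`
  (Ayoub 2014 Conj. 7). Period-conjecture strength; HARDEST; its own birth skeleton is
  `Lines/picut_localkernel_birth.lean` (cube-Nash normal form + Ayoub's Conjecture 7 in Ayoub's presentation).
* S2 `stub_piCancellation` — item stmt-KontsevichZagierPeriods-0540 BY NAME (`MultivaluedCoV.AyoubPiCancellation`):
  `[π]` is a non-zero-divisor modulo relations. Transcendence-free, printed open (HW 2022 App. A.4); birth
  skeleton `Lines/picut_cancellation_birth.lean` (normal form + kernel control mod κ + effective injectivity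
  for Ayoub's presentation; the 2-torsion step is the landed scaling division).

Proved here (no `sorry` outside the two stubs): `changeOfVariablesRel_subset_multiCoVRel` (rule (2) is
the one-sheet multivalued change of variables), `relations_le_plusClosure`, and the composition
`MultiCoVKernel_of : AyoubPiLocalKernel → AyoubPiCancellation → MultiCoVKernel` (pinned product exists →
π-peeling → KZ ⊆ KZ⁺), = the glue item stmt-17833 (`GlueProof.lean`). Why this dodges the "stuck goal" of
the crux as filed: the crux was summit-equivalent modulo the engine; after the cut the only
period-conjecture-strength leaf is the SHARED item 0541 (staffed once across five routes), the
transcendence-free seam 0540 is separately attackable/refutable (negation item 0542 exists), and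
`SheetTransfer` stays load-bearing in `closes` (the children reach `KZ.relations`; only the engine
identifies KZ⁺-derivability with KZ-derivability).
Disproof used: none relevant (no `Cruxes/MultiCoVKernel/Disproof.lean` exists at filing time).
-/

noncomputable section

set_option linter.dupNamespace false

namespace Summit.KontsevichZagierPeriods.KontsevichZagierPeriods.Cruxes.MultiCoVKernel.PiCut

open Set MeasureTheory
open Literature.NumberTheory.Transcendental
open Summit.KontsevichZagierPeriods.KontsevichZagierPeriods.Theses.MultivaluedCoV
  (MultiCoVKernel SheetTransfer AyoubPiLocalKernel AyoubPiCancellation MultiCoVKernelSplitGlue)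

/-! ## Registered stubs (open) -/

/-- **S1 = item stmt-KontsevichZagierPeriods-0541 (`AyoubPiLocalKernel`), by name.** π-local kernel:
Conjecture 1 for `P[1/[π]]` (Ayoub 2014 Def. 6 / Conj. 7 transcribed to the four moves). HARDEST —
period-conjecture strength. [cite: Ayoub2014, Def. 6 and Conj. 7] -/
theorem stub_piLocalKernel : AyoubPiLocalKernel := by
  sorry

/-- **S2 = item stmt-KontsevichZagierPeriods-0540 (`AyoubPiCancellation`), by name.** π-cancellation:
`[π]` is a non-zero-divisor on `FormalRep ⧸ relations`; transcendence-free; motivic shadow printed open.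
[cite: HuberWustholz2022, App. A.4] -/
theorem stub_piCancellation : AyoubPiCancellation := by
  sorry

/-! ## KZ⁺: the enlarged generator set -/

/-- The multivalued change-of-variables relators `[σ, Σ_k 1_{σ_k}·(g ∘ Φ_k)·|det Φ_k'|] − N·[τ, g]`
(the fourth generator set inside `MultiCoVKernel`, copied verbatim). [cite: KontsevichZagier2001, §1.2 rule (2)] -/
def multiCoVRel : Set KZ.FormalRep :=
  {c | ∃ (n N : ℕ) (r r' : Literature.NumberTheory.Transcendental.KZ.IntegralRep n) (σ : Fin N → Set (Fin n → ℝ)) (Φ : Fin N → (Fin n → ℝ) → (Fin n → ℝ)) (Φ' : Fin N → (Fin n → ℝ) → ((Fin n → ℝ) →L[ℝ] (Fin n → ℝ))), (∀ k, Literature.ModelTheory.ExponentialFields.IsSemialgebraic ℚ (σ k)) ∧ (∀ k, σ k ⊆ r.domain) ∧ MeasureTheory.volume (r.domain \ ⋃ k, σ k) = 0 ∧ (∀ k, Literature.NumberTheory.Transcendental.IsSemialgebraicMapOn ℚ (σ k) (Φ k)) ∧ (∀ k, ∀ x ∈ σ k, HasFDerivWithinAt (Φ k) (Φ' k x) (σ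 k) x) ∧ (∀ k, Set.InjOn (Φ k) (σ k)) ∧ (∀ k, Φ k '' σ k ⊆ r'.domain) ∧ (∀ k, MeasureTheory.volume (r'.domain \ Φ k '' σ k) = 0) ∧ (∀ x ∈ ⋃ k, σ k, r.integrand x = ∑ k : Fin N, (σ k).indicator (fun y => r'.integrand (Φ k y) * |(Φ' k y).det|) x) ∧ c = Literature.NumberTheory.Transcendental.KZ.of r - N • Literature.NumberTheory.Transcendental.KZ.of r'}

/-- The relations of the enlarged calculus KZ⁺: generated by (1a), (1b), (3) and the multivalued
change-of-variables relators. [cite: KontsevichZagier2001, §1.2] -/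
def plusClosure : AddSubgroup KZ.FormalRep :=
  AddSubgroup.closure (KZ.domainAddRel ∪ KZ.integrandAddRel ∪ KZ.newtonLeibnizRel ∪ multiCoVRel)

/-- **Rule (2) is the one-sheet multivalued change of variables.** A `changeOfVariablesRel` instance
`(r, r', Φ, Φ')` is the relator with `N = 1`, the single sheet `σ₀ = r.domain` and the map `Φ`: the
sheet is `ℚ`-semialgebraic and exhausts the domain, `Φ` is semialgebraic, differentiable within the
sheet and injective on it, its image is exactly `r'.domain` (so co-null there), the integrand identity
is `f x = f' (Φ x)·|det Φ' x|` on the sheet, and `[r] − 1 • [r'] = [r] − [r']`.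
[cite: KontsevichZagier2001, §1.2 rule (2)] -/
theorem changeOfVariablesRel_subset_multiCoVRel : KZ.changeOfVariablesRel ⊆ multiCoVRel := by
  rintro c ⟨n, r, r', Φ, Φ', hsa, hder, hinj, hdom, hf, rfl⟩
  refine ⟨n, 1, r, r', fun _ => r.domain, fun _ => Φ, fun _ => Φ', ?_, ?_, ?_, ?_, ?_, ?_, ?_, ?_, ?_, ?_⟩
  · intro _; exact r.isSemialgebraic_domain
  · intro _; exact Subset.rfl
  · simp [Set.iUnion_const]
  · intro _; exact hsa
  · intro _ x hx; exact hder x hx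
  · intro _; exact hinj
  · intro _; rw [hdom]
  · intro _; simp [hdom]
  · intro x hx
    have hx' : x ∈ r.domain := by simpa [Set.iUnion_const] using hx
    simp [Set.indicator_of_mem hx', hf x hx']
  · simp

/-- **Every KZ relation is a KZ⁺ relation**: (1a), (1b), (3) are generators of both, and rule (2) is
the one-sheet relator (`changeOfVariablesRel_subset_multiCoVRel`). [cite: KontsevichZagier2001, §1.2] -/
theorem relations_le_plusClosure : KZ.relations ≤ plusClosure := by
  refine (AddSubgroup.closure_le _).mpr ?_
  rintro c (((hc | hc) | hc) | hc)
  · exact AddSubgroup.subset_closure (Or.inl (Or.inl (Or.inl hc)))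
  · exact AddSubgroup.subset_closure (Or.inl (Or.inl (Or.inr hc)))
  · exact AddSubgroup.subset_closure (Or.inr (changeOfVariablesRel_subset_multiCoVRel hc))
  · exact AddSubgroup.subset_closure (Or.inl (Or.inr hc))

/-! ## Composition: the crux by name -/

/-- **The line's deciding step**: S1 → S2 → `MultiCoVKernel` BY NAME. A pinned product exists
(`exists_pinnedProduct`); for `c ∈ ker eval`, S1 gives `(lift (of ∘ P))^[N] c ∈ KZ.relations`, S2 peels the
`N` factors (induction on `N`), and `relations_le_plusClosure` (rule (2) = one-sheet multivalued CoV)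
moves the result into the KZ⁺ closure. [cite: Ayoub2014, Def. 6 and Conj. 7] -/
theorem MultiCoVKernel_of : AyoubPiLocalKernel → AyoubPiCancellation → MultiCoVKernel := by
  intro h₁ h₂
  unfold Summit.KontsevichZagierPeriods.KontsevichZagierPeriods.Theses.MultivaluedCoV.AyoubPiLocalKernel at h₁
  unfold Summit.KontsevichZagierPeriods.KontsevichZagierPeriods.Theses.MultivaluedCoV.AyoubPiCancellation at h₂
  obtain ⟨P, hP⟩ :=
    Summit.KontsevichZagierPeriods.HurwitzMicroSectors.NormalFormPrincipleSplitGlue.exists_pinnedProduct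
  intro c hc
  obtain ⟨N, hN⟩ := h₁ P hP c hc
  have hrel : c ∈ KZ.relations := by
    clear hc
    induction N with
    | zero => simpa using hN
    | succ N ih =>
      exact ih (h₂ P hP _ (by simpa only [Function.iterate_succ_apply'] using hN))
  exact relations_le_plusClosure hrel

/-- The crux from the registered stubs. [folklore] -/
theorem MultiCoVKernel_of_stubs : MultiCoVKernel := MultiCoVKernel_of stub_piLocalKernel stub_piCancellation

end Summit.KontsevichZagierPeriods.KontsevichZagierPeriods.Cruxes.MultiCoVKernel.PiCut

end
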